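import Mathlib
import Summits.Ventures.PercRepro2.Defs
import Summits.Ventures.PercRepro2.Graph
import Summits.Ventures.PercRepro2.HullDefs
import Summits.Ventures.PercRepro2.Harris

/-!
# The rigid lemma on decreasing classes, and the rigid ear lemma (blind cell PercRepro2, night-4 g5,
2026-08-24; proofs/NIGHT4-BRIDGE.md §9)

**Rigid lemma.** Let `D` be a DECREASING set of configurations and `R ζ ⊆ red ζ` a monotone choice
of red edges.  Then there is a permutation `τ` of `D` under which every edge of `R ζ` is blue in
`τ ζ` (`exists_rigidPerm_of_isLowerSet`).  Proof: by Hall it suffices that, for every up-set `𝓕`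
of edge sets, `#{D : R ∈ 𝓕} ≤ #{D : blue ∈ 𝓕}`; Harris (mixed form) gives
`#{D : R ∈ 𝓕} · 2^m ≤ #D · #{R ∈ 𝓕}`, `R ⊆ red` gives `#{R ∈ 𝓕} ≤ #{red ∈ 𝓕}`, the colour swap
gives `#D = #D'` for the increasing class `D' = blue(D)`, Harris (upper form) gives
`#D' · #{red ∈ 𝓕} ≤ #{D' : red ∈ 𝓕} · 2^m`, and the swap again `#{D' : red ∈ 𝓕} = #{D : blue ∈ 𝓕}`.

**Rigid ear lemma.** On `{u ↮_R v, u ↔_B v}` (decreasing) there is a permutation turning every red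
edge inside `C_R(u) ∪ C_R(v)` blue (`exists_rigidEar`).  This is the second-side ingredient of the
2-cut (ear) composition of row 2′SW-ALL with the marks on one side.
-/

namespace Summit.Ventures.PercRepro2

namespace Rigid

open Hull

open scoped Classical

variable {V : Type*} {E : Type*} [Fintype E] [DecidableEq E]

/-- The red edge set of a configuration. -/
def redF (ζ : Config E) : Finset E := Finset.univ.filter fun e => ζ e = true

/-- The blue edge set of a configuration. -/
def blueF (ζ : Config E) : Finset E := Finset.univ.filter fun e => ζ e = false

omit [DecidableEq E] in
/-- Membership in the red set. -/
lemma mem_redF {ζ : Config E} {e : E} : e ∈ redF ζ ↔ ζ e = true := by simp [redF]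

omit [DecidableEq E] in
/-- Membership in the blue set. -/
lemma mem_blueF {ζ : Config E} {e : E} : e ∈ blueF ζ ↔ ζ e = false := by simp [blueF]

omit [DecidableEq E] in
/-- The red set of the swap is the blue set. -/
lemma redF_blue (ζ : Config E) : redF (blue ζ) = blueF ζ := by
  ext e; simp [redF, blueF, blue_apply]

omit [DecidableEq E] in
/-- The red set is monotone. -/
lemma redF_mono {ζ ζ' : Config E} (h : ζ ≤ ζ') : redF ζ ⊆ redF ζ' := by
  intro e he
  rw [mem_redF] at he ⊢
  have := h e; rw [he] at this
  exact Bool.le_iff_imp.1 this rfl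

omit [Fintype E] [DecidableEq E] in
/-- The swap is antitone. -/
lemma blue_antitone {ζ ζ' : Config E} (h : ζ ≤ ζ') : blue ζ' ≤ blue ζ := by
  intro e
  have := h e
  rw [blue_apply, blue_apply]
  cases h1 : ζ e
  · cases h2 : ζ' e <;> simp
  · rw [h1] at this
    cases h2 : ζ' e
    · rw [h2, Bool.le_iff_imp] at this; exact absurd (this rfl) Bool.false_ne_true
    · simp

omit [Fintype E] [DecidableEq E] in
/-- The swap maps a decreasing set onto an increasing one. -/
lemma isUpperSet_image_blue {D : Set (Config E)} (hD : IsLowerSet D) :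
    IsUpperSet (blue '' D) := by
  rintro ζ ζ' hle ⟨ξ, hξ, rfl⟩
  refine ⟨blue ζ', ?_, blue_blue _⟩
  have : blue ζ' ≤ blue (blue ξ) := blue_antitone hle
  rw [blue_blue] at this
  exact hD this hξ

/-- The number of configurations in an event. -/
noncomputable def cardOf (A : Set (Config E)) : ℕ := (Finset.univ.filter fun ζ => ζ ∈ A).card

/-- The fair coin on every edge. -/
def fair : E → ℚ := fun _ => 1 / 2

omit [Fintype E] [DecidableEq E] in
/-- The fair coin is an admissible weight vector. -/
lemma isProbVec_fair : IsProbVec (fair : E → ℚ) :=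
  ⟨fun _ => by norm_num [fair], fun _ => by norm_num [fair]⟩

omit [DecidableEq E] in
/-- Every configuration has weight `2^{-m}` under the fair coin. -/
lemma weight_fair (ζ : Config E) : weight (fair : E → ℚ) ζ = (1 / 2 : ℚ) ^ Fintype.card E := by
  unfold weight
  have h : ∀ e ∈ (Finset.univ : Finset E), edgeFactor (fair e) (ζ e) = (1 / 2 : ℚ) := by
    intro e _; cases ζ e <;> norm_num [edgeFactor, fair]
  rw [Finset.prod_congr rfl h, Finset.prod_const, Finset.card_univ]

/-- The probability of an event under the fair coin counts it. -/
lemma prob_fair (A : Set (Config E)) :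
    prob (fair : E → ℚ) A = ((1 / 2 : ℚ) ^ Fintype.card E) * (cardOf A : ℚ) := by
  unfold prob cardOf
  have : ∀ ζ : Config E, A.indicator (weight (fair : E → ℚ)) ζ =
      if ζ ∈ Finset.univ.filter (fun ζ => ζ ∈ A) then ((1 / 2 : ℚ) ^ Fintype.card E) else 0 := by
    intro ζ
    simp only [Set.indicator, weight_fair, Finset.mem_filter, Finset.mem_univ, true_and]
  rw [Finset.sum_congr rfl fun ζ _ => this ζ, Finset.sum_ite_mem, Finset.univ_inter,
    Finset.sum_const, nsmul_eq_mul, mul_comm]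

omit [Fintype E] [DecidableEq E] in
/-- Clearing the factor `q = 2^{-m}` from a Harris inequality (upper form). -/
lemma aux_le {q a b c t : ℚ} (hqt : q * t = 1) (ht : 0 ≤ t) (h : q * a * (q * b) ≤ q * c) :
    a * b ≤ c * t := by
  calc a * b = (q * a * (q * b)) * (t * t) := by
        rw [show (q * a * (q * b)) * (t * t) = (q * t) * (q * t) * (a * b) by ring, hqt]; ring
    _ ≤ (q * c) * (t * t) := mul_le_mul_of_nonneg_right h (by positivity)
    _ = c * t := by rw [show (q * c) * (t * t) = (q * t) * (c * t) by ring, hqt]; ring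

omit [Fintype E] [DecidableEq E] in
/-- Clearing the factor `q = 2^{-m}` from a Harris inequality (mixed form). -/
lemma aux_ge {q a b c t : ℚ} (hqt : q * t = 1) (ht : 0 ≤ t) (h : q * c ≤ q * a * (q * b)) :
    c * t ≤ a * b := by
  calc c * t = (q * c) * (t * t) := by rw [show (q * c) * (t * t) = (q * t) * (c * t) by ring, hqt]; ring
    _ ≤ (q * a * (q * b)) * (t * t) := mul_le_mul_of_nonneg_right h (by positivity)
    _ = a * b := by
        rw [show (q * a * (q * b)) * (t * t) = (q * t) * (q * t) * (a * b) by ring, hqt]; ring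

omit [Fintype E] [DecidableEq E] in
/-- `2^{-k} · 2^k = 1`. -/
lemma half_pow_mul_two_pow (k : ℕ) : ((1 / 2 : ℚ) ^ k) * (2 : ℚ) ^ k = 1 := by
  rw [← mul_pow]; norm_num

/-- **Harris, mixed counting form on the cube**: `#(X ∩ Y) · 2^m ≤ #X · #Y` for `X` decreasing and `Y`
increasing. -/
lemma card_inter_mul_le {X Y : Set (Config E)} (hX : IsLowerSet X) (hY : IsUpperSet Y) :
    cardOf (X ∩ Y) * 2 ^ Fintype.card E ≤ cardOf X * cardOf Y := by
  have h := prob_inter_le_prob_mul_prob_of_isLowerSet (isProbVec_fair (E := E)) hX hY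
  rw [prob_fair, prob_fair, prob_fair] at h
  exact_mod_cast aux_ge (half_pow_mul_two_pow (Fintype.card E)) (by positivity) h

/-- **Harris, upper counting form on the cube**: `#X · #Y ≤ #(X ∩ Y) · 2^m` for increasing `X`, `Y`. -/
lemma card_mul_le_inter {X Y : Set (Config E)} (hX : IsUpperSet X) (hY : IsUpperSet Y) :
    cardOf X * cardOf Y ≤ cardOf (X ∩ Y) * 2 ^ Fintype.card E := by
  have h := prob_mul_prob_le_prob_inter (isProbVec_fair (E := E)) hX hY
  rw [prob_fair, prob_fair, prob_fair] at h
  exact_mod_cast aux_le (half_pow_mul_two_pow (Fintype.card E)) (by positivity) h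

/-- The swap is a bijection between `{D : blue ∈ 𝓕}` and `{blue D : red ∈ 𝓕}`. -/
lemma card_blue_eq (D : Finset (Config E)) (𝓕 : Set (Finset E)) :
    (D.filter fun ζ => blueF ζ ∈ 𝓕).card =
      cardOf ((blue '' (↑D : Set (Config E))) ∩ {ζ | redF ζ ∈ 𝓕}) := by
  unfold cardOf
  refine Finset.card_bij (fun ζ _ => blue ζ) ?_ ?_ ?_
  · intro ζ hζ
    rw [Finset.mem_filter] at hζ
    simp only [Finset.mem_filter, Finset.mem_univ, true_and, Set.mem_inter_iff, Set.mem_image,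
      Finset.mem_coe, Set.mem_setOf_eq, redF_blue]
    exact ⟨⟨ζ, hζ.1, rfl⟩, hζ.2⟩
  · intro ζ _ ζ' _ h
    have := congrArg blue h
    simpa [blue_blue] using this
  · intro η hη
    simp only [Finset.mem_filter, Finset.mem_univ, true_and, Set.mem_inter_iff, Set.mem_image,
      Finset.mem_coe, Set.mem_setOf_eq] at hη
    obtain ⟨⟨ζ, hζ, rfl⟩, hred⟩ := hη
    refine ⟨ζ, ?_, rfl⟩
    rw [Finset.mem_filter]
    rw [redF_blue] at hred
    exact ⟨hζ, hred⟩

/-- The cardinality of a decreasing class equals that of its swap. -/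
lemma card_image_blue (D : Finset (Config E)) :
    cardOf (blue '' (↑D : Set (Config E))) = D.card := by
  unfold cardOf
  symm
  refine Finset.card_bij (fun ζ _ => blue ζ) ?_ ?_ ?_
  · intro ζ hζ
    simp only [Finset.mem_filter, Finset.mem_univ, true_and, Set.mem_image, Finset.mem_coe]
    exact ⟨ζ, hζ, rfl⟩
  · intro ζ _ ζ' _ h
    have := congrArg blue h
    simpa [blue_blue] using this
  · intro η hη
    simp only [Finset.mem_filter, Finset.mem_univ, true_and, Set.mem_image, Finset.mem_coe] at hη
    obtain ⟨ζ, hζ, rfl⟩ := hη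
    exact ⟨ζ, hζ, rfl⟩

/-- **The counting inequality of the rigid lemma**: for a decreasing class `D`, a monotone choice
`R ζ ⊆ red ζ` and an up-set `𝓕` of edge sets, `#{D : R ∈ 𝓕} ≤ #{D : blue ∈ 𝓕}`. -/
theorem card_rigid_le (D : Finset (Config E)) (hD : IsLowerSet (↑D : Set (Config E)))
    (R : Config E → Finset E) (hR : ∀ ζ, R ζ ⊆ redF ζ) (hRmono : ∀ ζ ζ', ζ ≤ ζ' → R ζ ⊆ R ζ')
    (𝓕 : Set (Finset E)) (h𝓕 : IsUpperSet 𝓕) :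
    (D.filter fun ζ => R ζ ∈ 𝓕).card ≤ (D.filter fun ζ => blueF ζ ∈ 𝓕).card := by
  -- the events
  set I : Set (Config E) := {ζ | R ζ ∈ 𝓕} with hI
  set Fr : Set (Config E) := {ζ | redF ζ ∈ 𝓕} with hFr
  have hIup : IsUpperSet I := by
    intro ζ ζ' hle hζ
    exact h𝓕 (hRmono ζ ζ' hle) hζ
  have hFrup : IsUpperSet Fr := by
    intro ζ ζ' hle hζ
    exact h𝓕 (redF_mono hle) hζ
  have hIFr : ∀ ζ, ζ ∈ I → ζ ∈ Fr := fun ζ hζ => h𝓕 (hR ζ) hζ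
  -- step 1: Harris mixed on `D ∩ I`
  have h1 : cardOf ((↑D : Set (Config E)) ∩ I) * 2 ^ Fintype.card E ≤
      cardOf (↑D : Set (Config E)) * cardOf I := card_inter_mul_le hD hIup
  -- step 2: `#I ≤ #Fr`
  have h2 : cardOf I ≤ cardOf Fr := by
    unfold cardOf
    exact Finset.card_le_card (fun ζ hζ => by
      rw [Finset.mem_filter] at hζ ⊢; exact ⟨hζ.1, hIFr ζ hζ.2⟩)
  -- step 3: Harris upper on `blue D ∩ Fr`
  have h3 : cardOf (blue '' (↑D : Set (Config E))) * cardOf Fr ≤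
      cardOf ((blue '' (↑D : Set (Config E))) ∩ Fr) * 2 ^ Fintype.card E :=
    card_mul_le_inter (isUpperSet_image_blue hD) hFrup
  rw [card_image_blue] at h3
  -- assemble
  have hD' : cardOf ((↑D : Set (Config E)) ∩ I) = (D.filter fun ζ => R ζ ∈ 𝓕).card := by
    unfold cardOf; congr 1; ext ζ; simp [I]
  have hDD : cardOf (↑D : Set (Config E)) = D.card := by
    unfold cardOf; congr 1; ext ζ; simp
  rw [card_blue_eq]
  have hpos : 0 < 2 ^ Fintype.card E := by positivity
  have key : (D.filter fun ζ => R ζ ∈ 𝓕).card * 2 ^ Fintype.card E ≤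
      cardOf ((blue '' (↑D : Set (Config E))) ∩ Fr) * 2 ^ Fintype.card E := by
    calc (D.filter fun ζ => R ζ ∈ 𝓕).card * 2 ^ Fintype.card E
        = cardOf ((↑D : Set (Config E)) ∩ I) * 2 ^ Fintype.card E := by rw [hD']
      _ ≤ cardOf (↑D : Set (Config E)) * cardOf I := h1
      _ ≤ cardOf (↑D : Set (Config E)) * cardOf Fr := Nat.mul_le_mul_left _ h2
      _ = D.card * cardOf Fr := by rw [hDD]
      _ ≤ _ := h3
  exact Nat.le_of_mul_le_mul_right key hpos

/-- **The rigid lemma on decreasing classes**: a decreasing class `D` and a monotone choice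
`R ζ ⊆ red ζ` admit a permutation of `D` under which every edge of `R ζ` is blue in the image. -/
theorem exists_rigidPerm_of_isLowerSet (D : Finset (Config E)) (hD : IsLowerSet (↑D : Set (Config E)))
    (R : Config E → Finset E) (hR : ∀ ζ, R ζ ⊆ redF ζ) (hRmono : ∀ ζ ζ', ζ ≤ ζ' → R ζ ⊆ R ζ') :
    ∃ f : {ζ // ζ ∈ D} → Config E, Function.Injective f ∧
      ∀ x, f x ∈ D ∧ ∀ e ∈ R x.1, f x e = false := by
  let t : {ζ // ζ ∈ D} → Finset (Config E) := fun x => D.filter fun η => ∀ e ∈ R x.1, η e = false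
  have hall : ∀ s : Finset {ζ // ζ ∈ D}, s.card ≤ (s.biUnion t).card := by
    intro s
    obtain ⟨𝓕, h𝓕, h𝓕mem⟩ : ∃ 𝓕 : Set (Finset E), IsUpperSet 𝓕 ∧ ∀ F, F ∈ 𝓕 ↔ ∃ x ∈ s, R x.1 ⊆ F :=
      ⟨{F | ∃ x ∈ s, R x.1 ⊆ F}, fun F F' hFF' ⟨x, hx, hxF⟩ => ⟨x, hx, hxF.trans hFF'⟩,
        fun F => Iff.rfl⟩
    have e1 : s.biUnion t = D.filter fun η => blueF η ∈ 𝓕 := by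
      ext η
      simp only [Finset.mem_biUnion, Finset.mem_filter, t, h𝓕mem]
      constructor
      · rintro ⟨x, hx, hη, hsub⟩
        exact ⟨hη, x, hx, fun e he => mem_blueF.2 (hsub e he)⟩
      · rintro ⟨hη, x, hx, hsub⟩
        exact ⟨x, hx, hη, fun e he => mem_blueF.1 (hsub he)⟩
    have e2 : s.card ≤ (D.filter fun ζ => R ζ ∈ 𝓕).card := by
      refine Finset.card_le_card_of_injOn (fun x => x.1) ?_ ?_
      · intro x hx
        rw [Finset.mem_coe] at hx
        simp only [Finset.mem_coe, Finset.mem_filter, h𝓕mem]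
        exact ⟨x.2, x, hx, le_rfl⟩
      · intro x _ y _ hxy
        exact Subtype.ext hxy
    calc s.card ≤ (D.filter fun ζ => R ζ ∈ 𝓕).card := e2
      _ ≤ (D.filter fun ζ => blueF ζ ∈ 𝓕).card := card_rigid_le D hD R hR hRmono 𝓕 h𝓕
      _ = (s.biUnion t).card := by rw [e1]
  obtain ⟨f, hf, hft⟩ := (Finset.all_card_le_biUnion_card_iff_exists_injective t).1 hall
  refine ⟨f, hf, fun x => ?_⟩
  have := hft x
  simp only [t, Finset.mem_filter] at this
  exact this

/-! ## The rigid ear lemma -/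

variable (ends : E → Sym2 V)

/-- The class `{u ↮_R v, u ↔_B v}`. -/
noncomputable def earClass (u v : V) : Finset (Config E) :=
  Finset.univ.filter fun ζ => ¬ Conn ends ζ u v ∧ Conn ends (blue ζ) u v

/-- The class is decreasing. -/
lemma isLowerSet_earClass (u v : V) : IsLowerSet (↑(earClass ends u v) : Set (Config E)) := by
  intro ζ' ζ hle hζ'
  simp only [Finset.mem_coe, earClass, Finset.mem_filter, Finset.mem_univ, true_and] at hζ' ⊢
  refine ⟨fun hc => hζ'.1 ?_, ?_⟩
  · exact conn_mono hle hc
  · exact conn_mono (blue_antitone hle) hζ'.2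

/-- The red edges inside the red clusters of `u` and `v`. -/
noncomputable def earR (u v : V) (ζ : Config E) : Finset E :=
  Finset.univ.filter fun e => e ∈ within ends (cluster ends ζ u ∪ cluster ends ζ v) ∧ ζ e = true

omit [DecidableEq E] in
/-- `earR` consists of red edges. -/
lemma earR_subset (u v : V) (ζ : Config E) : earR ends u v ζ ⊆ redF ζ := by
  intro e he
  simp only [earR, Finset.mem_filter, Finset.mem_univ, true_and] at he
  exact mem_redF.2 he.2

omit [DecidableEq E] in
/-- `earR` is monotone. -/
lemma earR_mono (u v : V) {ζ ζ' : Config E} (hle : ζ ≤ ζ') : earR ends u v ζ ⊆ earR ends u v ζ' := by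
  intro e he
  simp only [earR, Finset.mem_filter, Finset.mem_univ, true_and] at he ⊢
  obtain ⟨⟨x, hx, y, hy, hends⟩, hred⟩ := he
  refine ⟨⟨x, ?_, y, ?_, hends⟩, ?_⟩
  · exact hx.elim (fun h => Or.inl (cluster_mono hle u h)) (fun h => Or.inr (cluster_mono hle v h))
  · exact hy.elim (fun h => Or.inl (cluster_mono hle u h)) (fun h => Or.inr (cluster_mono hle v h))
  · have := hle e; rw [hred] at this; exact Bool.le_iff_imp.1 this rfl

/-- **The rigid ear lemma**: on `{u ↮_R v, u ↔_B v}` there is a permutation turning every red edge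
inside `C_R(u) ∪ C_R(v)` blue. -/
theorem exists_rigidEar (u v : V) :
    ∃ f : {ζ // ζ ∈ earClass ends u v} → Config E, Function.Injective f ∧
      ∀ x, f x ∈ earClass ends u v ∧
        ∀ e, e ∈ within ends (cluster ends x.1 u ∪ cluster ends x.1 v) → x.1 e = true →
          f x e = false := by
  obtain ⟨f, hf, hmem⟩ := exists_rigidPerm_of_isLowerSet (earClass ends u v)
    (isLowerSet_earClass ends u v) (earR ends u v) (earR_subset ends u v)
    (fun ζ ζ' hle => earR_mono ends u v hle)
  refine ⟨f, hf, fun x => ⟨(hmem x).1, fun e he hred => (hmem x).2 e ?_⟩⟩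
  simp only [earR, Finset.mem_filter, Finset.mem_univ, true_and]
  exact ⟨he, hred⟩

end Rigid

end Summit.Ventures.PercRepro2
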